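import Summits.Ventures.QEC.CircuitDistance.ETowerK345X
import Summits.Ventures.QEC.CircuitDistance.ETowerBase
import HarnessLib

/-!
# E-fold tower ([[144,12,12]] under CNOT order #345, W = 10, node J) — sector X, slice 282 of `T3X`

#345 tower (R154 (3) / R159; CARD-7/CARD-8 idea-1; generic port + STEP2-ASSEMBLY-SPEC shapes of type-1 g2; node J = LEVER J, CARD-9, soundness `ETowerLeverJ`). `T3X` = the canonical (orbit-minimal) representatives of the
non-zero `V₃`-kernel base words of weight `≤ 10` of the extended `E(3,3)` table `TE3` (sector X, idea-1 slot order), as ASCENDING numerals, cut into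
consecutive slices `SX_i` (`T3X = SX_0 ++ SX_1 ++ …`, module `ETowerT3345X`). Per slice: the UNIT fact (§B8 (ii)) — the nested guarded tower
`nodeA` (levels A→B→C→`ktop`) passes on `bitsOf 45 0 u` for every `u` — and the BASE-SLICE fact (§B9) — `sliceCheck` (below `2^45`, kernel word of
`tab TE3 15`, weight in `[1,10]`, orbit-minimal) and the per-weight orbit-size sums `osums`. All `decide +kernel`; predicted kernel seconds = idea-1's
`enest` K-node model × calib × J ratio. No `native_decide`. Emitted with `emit_step2_345.py` (idea-1 g4 patch of eng-1 g2's `emit_step2.py`). Nothing here asserts a value of `d_circ`.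
-/

set_option maxRecDepth 100000

namespace Summit.Ventures.QEC.CircuitDistance.ETower.Sec345X

open Summit.Ventures.QEC.Census Summit.Ventures.QEC.Census.Fold

/-- slice 282 of `T3X`: 1 canonical base words (weights [4]; predicted 98.3 s on node J; s ≥ 1-rich). -/
def SX_282 : List ℕ := [618611605504]

set_option maxHeartbeats 400000000 in
/-- UNIT FACT (§B8 (ii)): every word of slice 282 passes the tower `nodeA`. -/
theorem unitsX_282 : (SX_282.map (bitsOf 45 0)).all nodeA = true := by decide +kernel

set_option maxHeartbeats 400000000 in
/-- BASE-SLICE FACT (§B9): slice 282 passes `sliceCheck` over `tab TE3 15` and has per-weight orbit-size sums `[0, 0, 0, 9, 0, 0, 0, 0, 0, 0]`. -/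
theorem baseX_282 : sliceCheck (tab TE3 15) 3 3 5 10 SX_282 = true ∧ osums 3 3 5 10 SX_282 = [0, 0, 0, 9, 0, 0, 0, 0, 0, 0] := by decide +kernel

end Summit.Ventures.QEC.CircuitDistance.ETower.Sec345X
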